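import Summits.AtomisticToContinuum.Crystallization.Theorems.PalmUnimodularRigidityLayeredLawsSelectHcpLocalCongruenceFrames
import Literature.Geometry.DiscreteGeometry.KissingRigidity
import Literature.Probability.Process.PointStationaryLaw

/-!
# Local congruence ⇒ global congruence, IV: labelled exact stars, frames agree, propagation
(stub `stub_localCongruence` of line `mtp-prestress-split-ergodic-frame`, crux `LayeredLawsSelectHcp`,
stmt-AtomisticToContinuum-9226; part 4 of 4 — proves the registered stub)

The discrete-Liouville ENDGAME of the rigidity half. Read an hcp-charted `S ∋ 0` as `X(ℤ³)` through
its chart re-rooted at the label of `0` (`hcpStacking_homogeneous`), with touching ↔ bonded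
(`0 < dist ≤ 28/25`). Then:

1. `rootStar_reroot_eq`: the root star of `count|(S − X v)` is `{X (nbr v ε) − X v : ε ∈ hcpStarIdx}`
   (chart + shell gap);
2. `exists_frame` (**labelled exact star**): `starDefect = 0` at `X v` gives an exact copy of the
   relaxed star with SOME labelling (part 3); the induced relabelling of `hcpStarIdx` is injective and
   preserves touching (chart), hence is an isometry of the relaxed star (part 2,
   `stub_localCongruenceStarAut`); so the NATURAL labelling is exact as well, and a linear isometry
   `A_v` with `X (nbr v ε) − X v = A_v (twist v (hcpSite a₀ h₀ ε))` is read off three independent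
   struts (`KissingRigidity.exists_linearIsometry_of_inner_eq`);
3. `frame_agree`: for touching `v, w` the frames agree on the bond and on the vectors to two common
   neighbours — three lattice vectors of non-zero determinant (part 1, `star_common`) — so `A_v = A_w`;
4. `exists_global_frame`: the axis steps of `ℤ³` are bonds, so induction from `X 0 = 0` gives ONE `A`
   with `X u = A (hcpSite a₀ h₀ u)` for all `u`, i.e. `S = A '' hcpStacking a₀ h₀`
   (`stub_localCongruence`).

Pure geometry: no potential, no measure theory beyond reading the atoms of `count|(S − x)`
(`count_restrict_singleton_ne_zero_iff`). All `[folklore]`.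
-/

noncomputable section

namespace Summit.AtomisticToContinuum.Crystallization.Theorems.PalmUnimodularRigidity.LayeredLawsSelectHcp

open MeasureTheory Set
open Literature.MathematicalPhysics.StatisticalMechanics Literature.Geometry.DiscreteGeometry

/-! ## Part D — labelled exact stars, frames agree along bonds, propagation, conclusion -/

section Main

open Summit.AtomisticToContinuum.Crystallization.Theorems.LayeredLawsSelectHcp.Negative.DiracLaws (GoodShell)
open scoped RealInnerProductSpace

/-- Euclidean `3`-space. [folklore] -/
local notation "E3" => EuclideanSpace ℝ (Fin 3)
/-- The ideal hcp sites. [folklore] -/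
local notation "Pᵢ" => hcpSite 1 (Real.sqrt (2 / 3))

section Core

variable {a₀ h₀ : ℝ} (ha₁ : 189 / 200 ≤ a₀) (ha₂ : a₀ ≤ 199 / 200) (hh₁ : 77 / 100 ≤ h₀) (hh₂ : h₀ ≤ 163 / 200)
variable {S : Set E3} {X : ℤ × ℤ × ℤ → E3}
variable (hXS : ∀ u, X u ∈ S) (hSX : ∀ y ∈ S, ∃ u, X u = y)
variable (hchart : ∀ u w, dist (Pᵢ u) (Pᵢ w) = 1 ↔ 0 < dist (X u) (X w) ∧ dist (X u) (X w) ≤ 28 / 25)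
variable (hgood : ∀ x ∈ S, GoodShell S x)
variable (hdef : ∀ x ∈ S,
  starDefect a₀ h₀ ((Measure.count : Measure E3).restrict ((fun z : E3 => z - x) '' S)) = 0)

include hXS hSX hchart hgood in
/-- **The root star of the configuration re-rooted at `X v` is the labelled image of the twelve
neighbours of `v`** (chart: bonded ↔ touching; good shell: no points with `101/100 < dist ≤ 9/8`).
[folklore] -/
theorem rootStar_reroot_eq (v : ℤ × ℤ × ℤ) :
    rootStar ((Measure.count : Measure E3).restrict ((fun z : E3 => z - X v) '' S)) =
      (fun ε => X (nbr v ε) - X v) '' ↑hcpStarIdx := by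
  ext y
  simp only [rootStar, Set.mem_setOf_eq, Literature.Probability.Process.count_restrict_singleton_ne_zero_iff,
    Set.mem_image, Finset.mem_coe]
  constructor
  · rintro ⟨⟨z, hzS, rfl⟩, hpos, hle⟩
    obtain ⟨u, rfl⟩ := hSX z hzS
    have hd : 0 < dist (X u) (X v) ∧ dist (X u) (X v) ≤ 28 / 25 := by
      rw [dist_eq_norm]; exact ⟨hpos, by linarith⟩
    have h1 : dist (Pᵢ v) (Pᵢ u) = 1 := by rw [dist_comm]; exact (hchart u v).2 hd
    obtain ⟨ε, hε, rfl⟩ := (dist_ideal_eq_one_iff_nbr v u).1 h1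
    exact ⟨ε, hε, rfl⟩
  · rintro ⟨ε, hε, rfl⟩
    have h1 : dist (Pᵢ v) (Pᵢ (nbr v ε)) = 1 := (dist_ideal_eq_one_iff_nbr v _).2 ⟨ε, hε, rfl⟩
    obtain ⟨hpos, hle⟩ := (hchart v (nbr v ε)).1 h1
    refine ⟨⟨X (nbr v ε), hXS _, rfl⟩, ?_, ?_⟩
    · rwa [← dist_eq_norm, dist_comm]
    · have hne : X (nbr v ε) ≠ X v := fun h => by rw [h, dist_self] at hpos; exact lt_irrefl _ hpos
      have := dist_le_of_goodShell (hgood _ (hXS v)) (hXS _) hne (by rw [dist_comm]; linarith)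
      rw [← dist_eq_norm]; linarith

include ha₁ ha₂ hh₁ hh₂ hXS hSX hchart hgood hdef in
/-- **Labelled exact star.** At every site `v` there is a linear isometry `A_v` carrying the twisted
relaxed reference star, label by label, onto the re-rooted star: `X (nbr v ε) − X v = A_v (twist v (hcpSite a₀ h₀ ε))`.
The vanishing defect gives an exact copy with SOME labelling (`stub_localCongruenceExactStar`); the
induced relabelling is an automorphism of the contact graph (chart), hence an isometry of the relaxed
star (`stub_localCongruenceStarAut`), so the NATURAL labelling is an exact copy too; a linear isometry
is then read off three independent struts (`exists_linearIsometry_of_inner_eq`). [folklore] -/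
theorem exists_frame (v : ℤ × ℤ × ℤ) : ∃ A : E3 ≃ₗᵢ[ℝ] E3, ∀ ε ∈ hcpStarIdx,
    X (nbr v ε) - X v = A (twist v (hcpSite a₀ h₀ ε)) := by
  have ha0 : a₀ ≠ 0 := by intro h; rw [h] at ha₁; norm_num at ha₁
  have hh0 : h₀ ≠ 0 := by intro h; rw [h] at hh₁; norm_num at hh₁
  set R : ℤ × ℤ × ℤ → E3 := hcpSite a₀ h₀ with hR
  -- the star as a finset
  set ZF : Finset E3 := hcpStarIdx.image fun ε => X (nbr v ε) - X v with hZF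
  have hZ : rootStar ((Measure.count : Measure E3).restrict ((fun z : E3 => z - X v) '' S)) = ↑ZF := by
    rw [rootStar_reroot_eq hXS hSX hchart hgood, hZF, Finset.coe_image]
  have hZne : ZF.Nonempty := Finset.image_nonempty.2 ⟨(0, 1, 0), by decide⟩
  have h0 : (⨅ A : E3 ≃ₗᵢ[ℝ] E3, ∑ w ∈ hcpStarIdx, Metric.infDist (A (hcpSite a₀ h₀ w)) ↑ZF ^ 2) = 0 := by
    have := hdef (X v) (hXS v)
    rwa [starDefect, hZ] at this
  obtain ⟨g, hgZ, hgn, hgd⟩ := stub_localCongruenceExactStar a₀ h₀ ZF hZne h0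
  -- the induced relabelling `π`
  have hlab : ∀ δ ∈ hcpStarIdx, ∃ ε ∈ hcpStarIdx, X (nbr v ε) - X v = g δ := fun δ hδ => by
    have := hgZ δ hδ
    rw [hZF, Finset.mem_image] at this
    exact this
  choose! π hπmem hπeq using hlab
  have hgne : ∀ δ ∈ hcpStarIdx, ∀ δ' ∈ hcpStarIdx, δ ≠ δ' → 0 < dist (g δ) (g δ') := by
    intro δ hδ δ' hδ' hne
    rw [hgd δ hδ δ' hδ']
    by_cases h1 : dist (Pᵢ δ) (Pᵢ δ') = 1
    · exact (star_dist_le_one ha₁ ha₂ hh₁ hh₂ hδ hδ' h1).1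
    · linarith [star_dist_gt ha₁ hh₁ hδ hδ' hne h1]
  have hinj : Set.InjOn π ↑hcpStarIdx := by
    intro δ hδ δ' hδ' heq
    by_contra hne
    have := hgne δ hδ δ' hδ' hne
    rw [← hπeq δ hδ, ← hπeq δ' hδ', heq, dist_self] at this
    exact lt_irrefl _ this
  have hmaps : Set.MapsTo π ↑hcpStarIdx ↑hcpStarIdx := fun δ hδ => hπmem δ hδ
  have hsurj : Set.SurjOn π ↑hcpStarIdx ↑hcpStarIdx :=
    Finset.surjOn_of_injOn_of_card_le π hmaps hinj le_rfl
  -- `π` preserves touching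
  have hadj : ∀ δ ∈ hcpStarIdx, ∀ δ' ∈ hcpStarIdx,
      (dist (Pᵢ (π δ)) (Pᵢ (π δ')) = 1 ↔ dist (Pᵢ δ) (Pᵢ δ') = 1) := by
    intro δ hδ δ' hδ'
    by_cases hne : δ = δ'
    · subst hne; simp
    have e1 : dist (Pᵢ (nbr v (π δ))) (Pᵢ (nbr v (π δ'))) = dist (Pᵢ (π δ)) (Pᵢ (π δ')) := by
      rw [hcpSite_nbr, hcpSite_nbr, dist_add_left, LinearIsometryEquiv.dist_map]
    have e3 : dist (X (nbr v (π δ))) (X (nbr v (π δ'))) = dist (R δ) (R δ') := by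
      rw [← dist_sub_right _ _ (X v), hπeq δ hδ, hπeq δ' hδ', hgd δ hδ δ' hδ']
    rw [← e1, hchart, e3]
    constructor
    · rintro ⟨-, hle⟩
      by_contra h1
      linarith [star_dist_gt ha₁ hh₁ hδ hδ' hne h1]
    · intro h1
      obtain ⟨hpos, hle1⟩ := star_dist_le_one ha₁ ha₂ hh₁ hh₂ hδ hδ' h1
      exact ⟨hpos, by linarith⟩
  have haut := stub_localCongruenceStarAut a₀ h₀ π hinj hmaps hadj
  -- the naturally labelled star has the metric of the twisted reference star
  set T : E3 ≃ₗᵢ[ℝ] E3 := twist v with hT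
  have hzd : ∀ ε ∈ hcpStarIdx, ∀ ε' ∈ hcpStarIdx,
      dist (X (nbr v ε) - X v) (X (nbr v ε') - X v) = dist (T (R ε)) (T (R ε')) := by
    intro ε hε ε' hε'
    obtain ⟨δ, hδ, rfl⟩ := hsurj hε
    obtain ⟨δ', hδ', rfl⟩ := hsurj hε'
    rw [hπeq δ hδ, hπeq δ' hδ', hgd δ hδ δ' hδ', LinearIsometryEquiv.dist_map, (haut δ hδ δ' hδ').1]
  have hzn : ∀ ε ∈ hcpStarIdx, ‖X (nbr v ε) - X v‖ = ‖T (R ε)‖ := by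
    intro ε hε
    obtain ⟨δ, hδ, rfl⟩ := hsurj hε
    rw [hπeq δ hδ, hgn δ hδ, LinearIsometryEquiv.norm_map, (haut δ hδ δ hδ).2]
  have hinner : ∀ ε ∈ hcpStarIdx, ∀ ε' ∈ hcpStarIdx,
      ⟪T (R ε), T (R ε')⟫ = ⟪X (nbr v ε) - X v, X (nbr v ε') - X v⟫ := fun ε hε ε' hε' =>
    inner_eq_of_norm_eq_of_dist_eq (hzn ε hε).symm (hzn ε' hε').symm (hzd ε hε ε' hε').symm
  -- a linear isometry from three independent struts
  have m0 : ((0, 1, 0) : ℤ × ℤ × ℤ) ∈ hcpStarIdx := by decide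
  have m1 : ((0, 0, 1) : ℤ × ℤ × ℤ) ∈ hcpStarIdx := by decide
  have m2 : ((1, 0, 0) : ℤ × ℤ × ℤ) ∈ hcpStarIdx := by decide
  set p : Fin 3 → E3 := ![T (R (0, 1, 0)), T (R (0, 0, 1)), T (R (1, 0, 0))] with hp
  set q : Fin 3 → E3 := ![X (nbr v (0, 1, 0)) - X v, X (nbr v (0, 0, 1)) - X v, X (nbr v (1, 0, 0)) - X v]
    with hq
  have hli : LinearIndependent ℝ p := by
    have h := (linearIndependent_three_struts ha0 hh0).map' T.toLinearEquiv.toLinearMap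
      T.toLinearEquiv.ker
    have hfun : ⇑T.toLinearEquiv.toLinearMap ∘ ![R (0, 1, 0), R (0, 0, 1), R (1, 0, 0)] = p := by
      funext i; fin_cases i <;> rfl
    rw [hfun] at h
    exact h
  have hpq : ∀ i j, ⟪p i, p j⟫ = ⟪q i, q j⟫ := by
    intro i j
    fin_cases i <;> fin_cases j <;>
      simp only [hp, hq, Fin.zero_eta, Fin.mk_one, Fin.reduceFinMk, Matrix.cons_val_zero,
        Matrix.cons_val_one, Matrix.cons_val] <;> exact hinner _ (by decide) _ (by decide)
  obtain ⟨A₀, hA₀⟩ := exists_linearIsometry_of_inner_eq hli hpq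
  set A : E3 ≃ₗᵢ[ℝ] E3 := A₀.toLinearIsometryEquiv rfl with hA
  have hAp : ∀ i, A (p i) = q i := fun i => by rw [hA, LinearIsometry.coe_toLinearIsometryEquiv]; exact hA₀ i
  have hlq : LinearIndependent ℝ q := by
    have h := hli.map' A.toLinearEquiv.toLinearMap A.toLinearEquiv.ker
    have hfun : ⇑A.toLinearEquiv.toLinearMap ∘ p = q := by
      funext i; exact hAp i
    rw [hfun] at h
    exact h
  refine ⟨A, fun ε hε => ?_⟩
  symm
  rw [← sub_eq_zero]
  refine eq_zero_of_inner_linearIndependent_fin_three hlq fun i => ?_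
  rw [inner_sub_left, sub_eq_zero, ← hAp i, A.inner_map_map, hAp i]
  fin_cases i
  · simpa [hp, hq] using hinner ε hε _ m0
  · simpa [hp, hq] using hinner ε hε _ m1
  · simpa [hp, hq] using hinner ε hε _ m2

include ha₁ ha₂ hh₁ hh₂ hXS hSX hchart hgood hdef in
/-- **Labelled exact star, bond form**: at every site `v` a linear isometry `A_v` with
`X w − X v = A_v (hcpSite a₀ h₀ w − hcpSite a₀ h₀ v)` for all touching `w`. [folklore] -/
theorem exists_frame' (v : ℤ × ℤ × ℤ) : ∃ A : E3 ≃ₗᵢ[ℝ] E3, ∀ w, dist (Pᵢ v) (Pᵢ w) = 1 →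
    X w - X v = A (hcpSite a₀ h₀ w - hcpSite a₀ h₀ v) := by
  obtain ⟨A, hA⟩ := exists_frame ha₁ ha₂ hh₁ hh₂ hXS hSX hchart hgood hdef v
  refine ⟨A, fun w hw => ?_⟩
  obtain ⟨ε, hε, rfl⟩ := (dist_ideal_eq_one_iff_nbr v w).1 hw
  rw [hcpSite_nbr a₀ h₀, add_sub_cancel_left]
  exact hA ε hε

include ha₁ hh₁ in
/-- **Frames agree along bonds.** If `v, w` touch and `A`, `B` are bond-form frames at `v`, `w`, then
`A = B`: both agree on the bond vector and on the vectors to two common neighbours, three vectors of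
non-zero lattice determinant (`star_common`). [folklore] -/
theorem frame_agree {v w : ℤ × ℤ × ℤ} (hvw : dist (Pᵢ v) (Pᵢ w) = 1) {A B : E3 ≃ₗᵢ[ℝ] E3}
    (hA : ∀ u, dist (Pᵢ v) (Pᵢ u) = 1 → X u - X v = A (hcpSite a₀ h₀ u - hcpSite a₀ h₀ v))
    (hB : ∀ u, dist (Pᵢ w) (Pᵢ u) = 1 → X u - X w = B (hcpSite a₀ h₀ u - hcpSite a₀ h₀ w)) :
    A = B := by
  have ha0 : a₀ ≠ 0 := by intro h; rw [h] at ha₁; norm_num at ha₁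
  have hh0 : h₀ ≠ 0 := by intro h; rw [h] at hh₁; norm_num at hh₁
  set R : ℤ × ℤ × ℤ → E3 := hcpSite a₀ h₀ with hR
  obtain ⟨ε, hε, rfl⟩ := (dist_ideal_eq_one_iff_nbr v w).1 hvw
  obtain ⟨γ₁, hγ₁, γ₂, hγ₂, hd₁, hd₂, hdet⟩ := star_common hε
  set T : E3 ≃ₗᵢ[ℝ] E3 := twist v with hT
  have hv1 : dist (Pᵢ v) (Pᵢ (nbr v γ₁)) = 1 := (dist_ideal_eq_one_iff_nbr _ _).2 ⟨γ₁, hγ₁, rfl⟩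
  have hv2 : dist (Pᵢ v) (Pᵢ (nbr v γ₂)) = 1 := (dist_ideal_eq_one_iff_nbr _ _).2 ⟨γ₂, hγ₂, rfl⟩
  have hw1 : dist (Pᵢ (nbr v ε)) (Pᵢ (nbr v γ₁)) = 1 := by
    rw [hcpSite_nbr, hcpSite_nbr, dist_add_left, LinearIsometryEquiv.dist_map, dist_comm]; exact hd₁
  have hw2 : dist (Pᵢ (nbr v ε)) (Pᵢ (nbr v γ₂)) = 1 := by
    rw [hcpSite_nbr, hcpSite_nbr, dist_add_left, LinearIsometryEquiv.dist_map, dist_comm]; exact hd₂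
  have hwv : dist (Pᵢ (nbr v ε)) (Pᵢ v) = 1 := by rw [dist_comm]; exact hvw
  -- `A` and `B` agree on three vectors
  have e0 : B (R v - R (nbr v ε)) = A (R v - R (nbr v ε)) := by
    rw [← hB v hwv, ← neg_sub, hA (nbr v ε) hvw, ← map_neg, neg_sub]
  have ec : ∀ γ, dist (Pᵢ v) (Pᵢ (nbr v γ)) = 1 → dist (Pᵢ (nbr v ε)) (Pᵢ (nbr v γ)) = 1 →
      B (R (nbr v γ) - R (nbr v ε)) = A (R (nbr v γ) - R (nbr v ε)) := by
    intro γ hvγ hwγ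
    rw [← hB _ hwγ, show X (nbr v γ) - X (nbr v ε) = (X (nbr v γ) - X v) - (X (nbr v ε) - X v) by abel,
      hA _ hvγ, hA _ hvw, ← map_sub]
    congr 1
    abel
  -- in lattice coordinates
  have r0 : R v - R (nbr v ε) = T (siteVec a₀ h₀ (-siteInt ε)) := by
    rw [hR, hcpSite_nbr, ← siteVec_neg, ← hcpSite_eq_siteVec, map_neg]
    abel
  have rc : ∀ γ, R (nbr v γ) - R (nbr v ε) = T (siteVec a₀ h₀ (siteInt γ - siteInt ε)) := by
    intro γ
    rw [hR, hcpSite_nbr, hcpSite_nbr, add_sub_add_left_eq_sub, ← map_sub, hcpSite_eq_siteVec,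
      hcpSite_eq_siteVec, siteVec_sub]
  have key : (B.toLinearEquiv.toLinearMap).comp T.toLinearEquiv.toLinearMap =
      (A.toLinearEquiv.toLinearMap).comp T.toLinearEquiv.toLinearMap := by
    refine linearMap_eq_of_eq_on_siteVec ha0 hh0 hdet ?_ ?_ ?_
    · simpa [r0] using e0
    · simpa [rc γ₁] using ec γ₁ hv1 hw1
    · simpa [rc γ₂] using ec γ₂ hv2 hw2
  refine LinearIsometryEquiv.ext fun x => ?_
  have := congrArg (fun f : E3 →ₗ[ℝ] E3 => f (T.symm x)) key
  simpa using this.symm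

/-- The six axis steps of `ℤ³` are bonds of the ideal hcp (for both parities). [folklore] -/
theorem dist_ideal_axis (v : ℤ × ℤ × ℤ) :
    dist (Pᵢ v) (Pᵢ (v.1 + 1, v.2.1, v.2.2)) = 1 ∧ dist (Pᵢ v) (Pᵢ (v.1 - 1, v.2.1, v.2.2)) = 1 ∧
    dist (Pᵢ v) (Pᵢ (v.1, v.2.1 + 1, v.2.2)) = 1 ∧ dist (Pᵢ v) (Pᵢ (v.1, v.2.1 - 1, v.2.2)) = 1 ∧
    dist (Pᵢ v) (Pᵢ (v.1, v.2.1, v.2.2 + 1)) = 1 ∧ dist (Pᵢ v) (Pᵢ (v.1, v.2.1, v.2.2 - 1)) = 1 := by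
  obtain ⟨k, i, j⟩ := v
  simp only [dist_ideal_eq_one_iff, siteQ, siteInt]
  have h1 : (k + 1) % 2 - k % 2 = 1 ∨ (k + 1) % 2 - k % 2 = -1 := by omega
  have h2 : (k - 1) % 2 - k % 2 = 1 ∨ (k - 1) % 2 - k % 2 = -1 := by omega
  refine ⟨?_, ?_, by ring, by ring, by ring, by ring⟩
  · rcases h1 with h | h <;> nlinarith [h]
  · rcases h2 with h | h <;> nlinarith [h]

include ha₁ ha₂ hh₁ hh₂ hXS hSX hchart hgood hdef in
/-- **Propagation**: one linear isometry `A` with `X u = A (hcpSite a₀ h₀ u)` for ALL `u` (frames agree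
along bonds, the axis steps connect `ℤ³`, `X 0 = 0`). [folklore] -/
theorem exists_global_frame (hX0 : X 0 = 0) : ∃ A : E3 ≃ₗᵢ[ℝ] E3, ∀ u, X u = A (hcpSite a₀ h₀ u) := by
  set R : ℤ × ℤ × ℤ → E3 := hcpSite a₀ h₀ with hR
  choose Af hAf using fun v => exists_frame' ha₁ ha₂ hh₁ hh₂ hXS hSX hchart hgood hdef v
  refine ⟨Af 0, ?_⟩
  -- one bond step
  have step : ∀ v w, dist (Pᵢ v) (Pᵢ w) = 1 → (X v = Af 0 (R v) ∧ Af v = Af 0) →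
      (X w = Af 0 (R w) ∧ Af w = Af 0) := by
    rintro v w hvw ⟨hXv, hAv⟩
    have heq : Af v = Af w := frame_agree ha₁ hh₁ hvw (hAf v) (hAf w)
    refine ⟨?_, by rw [← heq, hAv]⟩
    have h := hAf v w hvw
    rw [hAv] at h
    calc X w = X v + (X w - X v) := by abel
      _ = Af 0 (R v) + Af 0 (R w - R v) := by rw [h, hXv]
      _ = Af 0 (R w) := by rw [map_sub]; abel
  -- walk along the axes
  have base : X 0 = Af 0 (R 0) ∧ Af 0 = Af 0 := ⟨by rw [hR, hcpSite_zero, map_zero, hX0], rfl⟩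
  have hk : ∀ k : ℤ, X (k, 0, 0) = Af 0 (R (k, 0, 0)) ∧ Af (k, 0, 0) = Af 0 := by
    intro k
    induction k using Int.induction_on with
    | zero => exact base
    | succ n ih => exact step _ _ (dist_ideal_axis ((n : ℤ), 0, 0)).1 ih
    | pred n ih =>
      have := step _ _ (dist_ideal_axis (-(n : ℤ), 0, 0)).2.1 ih
      exact this
  have hki : ∀ k i : ℤ, X (k, i, 0) = Af 0 (R (k, i, 0)) ∧ Af (k, i, 0) = Af 0 := by
    intro k i
    induction i using Int.induction_on with
    | zero => exact hk k
    | succ n ih => exact step _ _ (dist_ideal_axis (k, (n : ℤ), 0)).2.2.1 ih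
    | pred n ih => exact step _ _ (dist_ideal_axis (k, -(n : ℤ), 0)).2.2.2.1 ih
  intro u
  obtain ⟨k, i, j⟩ := u
  suffices H : X (k, i, j) = Af 0 (R (k, i, j)) ∧ Af (k, i, j) = Af 0 from H.1
  induction j using Int.induction_on with
  | zero => exact hki k i
  | succ n ih => exact step _ _ (dist_ideal_axis (k, i, (n : ℤ))).2.2.2.2.1 ih
  | pred n ih => exact step _ _ (dist_ideal_axis (k, i, -(n : ℤ))).2.2.2.2.2 ih

end Core

/-- **STUB 6 (`stub_localCongruence`) — local congruence everywhere ⇒ global congruence.** If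
`0 ∈ S`, every point of `S` is `(1/100)`-good, `S` is hcp-charted and the congruence defect of the
re-rooted star vanishes at every point, then `S` is ONE linear-isometric copy of `hcpStacking a₀ h₀`:
re-root the chart at the label of `0` (`hcpStacking_homogeneous`), read `S` as `X(ℤ³)` with
`X 0 = 0`, and apply `exists_global_frame`. [folklore] -/
theorem stub_localCongruence : ∀ a₀ h₀ : ℝ, 189 / 200 ≤ a₀ → a₀ ≤ 199 / 200 → 77 / 100 ≤ h₀ → h₀ ≤ 163 / 200 → ∀ S : Set E3, (0 : E3) ∈ S → (∀ x ∈ S, GoodShell S x) → HcpCharted S → (∀ x ∈ S, starDefect a₀ h₀ ((Measure.count : Measure E3).restrict ((fun z : E3 => z - x) '' S)) = 0) → ∃ A : E3 ≃ₗᵢ[ℝ] E3, S = A '' hcpStacking a₀ h₀ := by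
  intro a₀ h₀ ha₁ ha₂ hh₁ hh₂ S h0 hgood hchart hdef
  obtain ⟨Φ, hbij, hbond⟩ := hchart
  obtain ⟨p₀, hp₀, hΦp₀⟩ := hbij.surjOn h0
  obtain ⟨B, hB⟩ := hcpStacking_homogeneous 1 (Real.sqrt (2 / 3)) hp₀
  set X : ℤ × ℤ × ℤ → E3 := fun u => Φ (p₀ + B (Pᵢ u)) with hX
  have hPmem : ∀ u, Pᵢ u ∈ hcpStacking 1 (Real.sqrt (2 / 3)) := fun u => barlowPos_mem _ _ _
  have hmem : ∀ u, p₀ + B (Pᵢ u) ∈ hcpStacking 1 (Real.sqrt (2 / 3)) := fun u => (hB _).1 (hPmem u)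
  have hXS : ∀ u, X u ∈ S := fun u => hbij.mapsTo (hmem u)
  have hSX : ∀ y ∈ S, ∃ u, X u = y := by
    intro y hy
    obtain ⟨p, hp, rfl⟩ := hbij.surjOn hy
    have hq : p₀ + B (B.symm (p - p₀)) = p := by simp
    have hqmem : B.symm (p - p₀) ∈ hcpStacking 1 (Real.sqrt (2 / 3)) := (hB _).2 (by rw [hq]; exact hp)
    obtain ⟨k, i, j, hqe⟩ := hqmem
    refine ⟨(k, i, j), ?_⟩
    change Φ (p₀ + B (barlowPos 1 (Real.sqrt (2 / 3)) alternatingHagg k i j)) = Φ p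
    rw [← hqe, hq]
  have hchart' : ∀ u w, dist (Pᵢ u) (Pᵢ w) = 1 ↔ 0 < dist (X u) (X w) ∧ dist (X u) (X w) ≤ 28 / 25 := by
    intro u w
    rw [← hbond _ (hmem u) _ (hmem w), dist_add_left, LinearIsometryEquiv.dist_map]
  have hX0 : X 0 = 0 := by
    change Φ (p₀ + B (hcpSite 1 (Real.sqrt (2 / 3)) 0)) = 0
    rw [hcpSite_zero, map_zero, add_zero, hΦp₀]
  obtain ⟨A, hA⟩ := exists_global_frame ha₁ ha₂ hh₁ hh₂ hXS hSX hchart' hgood hdef hX0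
  refine ⟨A, Set.ext fun y => ⟨fun hy => ?_, ?_⟩⟩
  · obtain ⟨u, rfl⟩ := hSX y hy
    exact ⟨hcpSite a₀ h₀ u, barlowPos_mem _ _ _, (hA u).symm⟩
  · rintro ⟨q, ⟨k, i, j, rfl⟩, rfl⟩
    have := hA (k, i, j)
    change X (k, i, j) = A (barlowPos a₀ h₀ alternatingHagg k i j) at this
    rw [← this]
    exact hXS _

end Main

end Summit.AtomisticToContinuum.Crystallization.Theorems.PalmUnimodularRigidity.LayeredLawsSelectHcp

end
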